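import Summits.Ventures.YMGap.RobustBall.MassGapOnBallMassiveRows
import Summits.Ventures.YMGap.RobustBall.MassGapOfDoorKR
import HarnessLib

/-!
# Venture YMGap, track ROBUST-BALL — the QUARTER-DOOR massive rows: ds-4's Kantorovich–Rubinstein door for
# `SU(2)` (one-link modulus `K = 1`, loads `(a, ℓ_s, Λ)`) read through «`PerturbedMassGapAt` ⇒ every DLR state of
# the member is massive», every `d` and `d = 4`

HONEST FRAMING. WHAT THIS IS: a venture file (cell `pub-ymgap`, track Y2 ROBUST-BALL, seat ds-3),
strong-coupling LATTICE statements for `SU(2)` lattice Yang–Mills on `ℤ^d` / `ℤ⁴` with a PERTURBED action.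
Kernel COMPOSITION only: ds-4's quarter door `su2_perturbedMassGapAt_quarter(_dim4)` (`MassGapOfDoorKR.lean`:
the `SU(2)` one-link modulus `K = 1` on `‖B‖_op ≤ 1` transferred to the member by the reweighting leg U1 with the
SELF-Lipschitz load `ℓ_s`, cross leg with `Λ`; row sum `(3/2)(d−1)|β_W| e^{a}(1 + 2√2 ℓ_s) + √2 Λ < 1`, `d = 4`:
`(9/2)|β_W| …`, zero loads `β_W < 2/9` — rb-theory's column Qgap, HEADLINE row 1c) composed with this seat's
member-level conversion (`massive_of_perturbedMassGapAt`, `MassGapOnBallMassiveRows.lean`; every-`d` clause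
`massiveClause_of_perturbedMassGapAt` below). RESULT (`su2_massive_quarter_dim4`, hypothesis-free): under the
quarter-door row sum, the member has DLR states on `ℤ⁴` and EVERY one is MASSIVE with exponentially decaying
plaquette–plaquette correlation function — the massive-state currency now reaches the quarter door's couplings
(`β_W < 2/9` at zero loads, beyond the pair doors' `1/6`). WHAT IT IS NOT: no new `(β⋆, ε)` number (the Qgap rows
`(1/8, 0.130), (1/6, 0.062), (1/5, 0.022)` are rb-theory's / rb-ref's certificates, to be typed by the rows
pipeline), no star/slab door; nothing about the continuum, confinement, a transfer-matrix gap or the Clay problem.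

References: R. L. Dobrushin (1970); H. Föllmer, LNM 1362 (1988) Ch. I; R. Holley, D. Stroock, J. Stat. Phys. 46
(1987) 1159; H. Shen, R. Zhu, X. Zhu, CMP 400 (2023); K. Osterwalder, E. Seiler, Ann. Phys. 110 (1978) §4;
rb-theory `HOME/rb/HEADLINE-CANDIDATES.md` row 1c, ds-4 `HOME/ds/ds4/ROBUST-TILT.md`.
-/

noncomputable section

open MeasureTheory ProbabilityTheory Function Finset Filter Topology
open scoped NNReal
open Literature.Probability.LatticeModels
open Literature.Probability.LatticeModels.DobrushinMetric
open Literature.MathematicalPhysics.QuantumLattice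
open Literature.MathematicalPhysics.QuantumFieldTheory hiding ZdEdge
open Literature.Barriers.QuantumFields (IsMassiveState)

namespace Summit.Ventures.YMGap.RobustBall

variable {d N : ℕ}

/-! ### Member level, every `d`: `PerturbedMassGapAt` ⇒ the Osterwalder–Seiler clause -/

/-- **EVERY `d ≥ 1`, member level**: `PerturbedMassGapAt d N β W supp` at a member `(W, supp) ∈ MemBallZd ε₀ ε₁ R`
(`N ≥ 1`) gives, for every DLR state of the member, ONE rate `m > 0` at which `cov_μ(F₁, F₂ ∘ θ_x)` decays
exponentially for ALL bounded measurable local observables (the body of `IsMassiveState` with `4 ↦ d`). -/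
theorem massiveClause_of_perturbedMassGapAt (hd : 1 ≤ d) (hN : 1 ≤ N) {β ε₀ ε₁ R : ℝ}
    {W : Potential (ZdEdge d) (Matrix.specialUnitaryGroup (Fin N) ℂ)}
    {supp : Finset (ZdEdge d) → Finset (Finset (ZdEdge d))} (hmem : MemBallZd ε₀ ε₁ R W supp)
    (h : PerturbedMassGapAt d N β W supp) :
    ∀ μ ∈ perturbedGibbsMeasures (d := d) (fundamentalRep (Fin N)) ((N : ℝ) * β) W supp,
      ∃ m : ℝ, ∀ F₁ F₂ : LGConfig d (Matrix.specialUnitaryGroup (Fin N) ℂ) → ℝ,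
        Literature.MathematicalPhysics.QuantumLattice.IsLocalObservable F₁ →
        Literature.MathematicalPhysics.QuantumLattice.IsLocalObservable F₂ →
        Measurable F₁ → Measurable F₂ → (∃ C, ∀ U, |F₁ U| ≤ C) → (∃ C, ∀ U, |F₂ U| ≤ C) →
          HasExponentialDecayRate
            (fun x : Site d => cov[F₁, fun U => F₂ (Literature.MathematicalPhysics.QuantumLattice.configShift x U); μ]) m := by
  intro μ hμ
  obtain ⟨c, hc, hcl⟩ := h.2 μ hμ
  refine ⟨c, fun F₁ F₂ h₁ h₂ h₁m h₂m hb₁ hb₂ => ?_⟩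
  obtain ⟨C, hC⟩ := perturbed_covariance_decay_of_memBallZd hd hN ((N : ℝ) * β) hmem hμ hc hcl F₁ F₂ h₁ h₂
    h₁m h₂m hb₁ hb₂
  exact ⟨hc, C, hC⟩

/-- Loads `(a, Λ)` with witnesses and a range bound make a member of `MemBallZd a Λ R` (the self-Lipschitz load
`ℓ_s` of the quarter door is extra information the ball does not record). -/
theorem memBallZd_of_loads {a Λ R : ℝ} {W : Potential (ZdEdge d) (Matrix.specialUnitaryGroup (Fin N) ℂ)}
    (hWc : ∀ X, Continuous (W X)) (hWdep : ∀ X, DependsOn (W X) (↑X : Set (ZdEdge d)))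
    {supp : Finset (ZdEdge d) → Finset (Finset (ZdEdge d))} (hsupp : W.IsSupportedBy supp)
    {osc : Finset (ZdEdge d) → ZdEdge d → ℝ} (hosc : ∀ X, Dobrushin.IsOscBound (W X) (osc X))
    (hosca : ∀ e, ∑ X ∈ (supp {e}).filter (fun X => e ∈ X), osc X e ≤ a)
    {lip : Finset (ZdEdge d) → ZdEdge d → ℝ} (hlip : ∀ X, IsLipBound suFrobDist (W X) (lip X))
    (hΛ : ∀ e, ∑ y ∈ perturbedNbr supp e, ∑ X ∈ (supp {e}).filter (fun X => e ∈ X), lip X y ≤ Λ)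
    (hR : ∀ e, ∀ X ∈ supp {e}, e ∈ X → ∀ y ∈ X, ‖e.1 - y.1‖ ≤ R) :
    MemBallZd a Λ R W supp where
  continuous := hWc
  dependsOn := hWdep
  supportedBy := hsupp
  range := hR
  loads := ⟨osc, lip, hosc, hlip, hosca, hΛ⟩

/-! ### `SU(2)`: the quarter door in the massive-state currency -/

/-- ★★ **`SU(2)`, `d = 4`, QUARTER DOOR ⇒ EVERY DLR STATE OF THE MEMBER IS MASSIVE, HYPOTHESIS-FREE** (Wilson units,
't Hooft `β_W/4`, tree coupling `(2:ℕ)·(β_W/4) = β_W/2`): for `|β_W| ≤ 2/3` and a member with continuous own-link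
terms, support family `supp` of range `R`, oscillation load `≤ a`, self-Lipschitz load `≤ ℓ_s`, cross-Lipschitz
load `≤ Λ` and `(9/2)|β_W| e^{a}(1 + 2√2 ℓ_s) + √2 Λ < 1` (ds-4's `su2_perturbedMassGapAt_quarter_dim4`), DLR states
exist and every one is a MASSIVE STATE with exponentially decaying plaquette–plaquette correlation function. Zero
loads: the quarter-modulus Wilson window `β_W < 2/9` in the massive-state currency (pair doors: `1/6`). -/
theorem su2_massive_quarter_dim4 {βW a ℓs Λ R : ℝ} (hℓs : 0 ≤ ℓs) (hβ : |βW| ≤ 2 / 3)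
    {W : Potential (ZdEdge 4) (Matrix.specialUnitaryGroup (Fin 2) ℂ)} (hWc : ∀ X, Continuous (W X))
    (hWdep : ∀ X, DependsOn (W X) (↑X : Set (ZdEdge 4)))
    {supp : Finset (ZdEdge 4) → Finset (Finset (ZdEdge 4))} (hsupp : W.IsSupportedBy supp)
    {osc : Finset (ZdEdge 4) → ZdEdge 4 → ℝ} (hosc : ∀ X, Dobrushin.IsOscBound (W X) (osc X))
    (hosca : ∀ e, ∑ X ∈ (supp {e}).filter (fun X => e ∈ X), osc X e ≤ a)
    {lip : Finset (ZdEdge 4) → ZdEdge 4 → ℝ} (hlip : ∀ X, IsLipBound suFrobDist (W X) (lip X))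
    (hlips : ∀ e, ∑ X ∈ (supp {e}).filter (fun X => e ∈ X), lip X e ≤ ℓs)
    (hΛ : ∀ e, ∑ y ∈ perturbedNbr supp e, ∑ X ∈ (supp {e}).filter (fun X => e ∈ X), lip X y ≤ Λ)
    (hR : ∀ e, ∀ X ∈ supp {e}, e ∈ X → ∀ y ∈ X, ‖e.1 - y.1‖ ≤ R)
    (hρ : 9 / 2 * |βW| * (Real.exp a * (1 + 2 * Real.sqrt 2 * ℓs)) + Real.sqrt 2 * Λ < 1) :
    (perturbedGibbsMeasures (d := 4) (fundamentalRep (Fin 2)) (((2 : ℕ) : ℝ) * (βW / 4)) W supp).Nonempty ∧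
      ∀ μ ∈ perturbedGibbsMeasures (d := 4) (fundamentalRep (Fin 2)) (((2 : ℕ) : ℝ) * (βW / 4)) W supp,
        IsMassiveState μ ∧ HasExponentialDecay (plaquetteCorrFn (fundamentalRep (Fin 2)) μ) :=
  massive_of_perturbedMassGapAt (by norm_num) (memBallZd_of_loads hWc hWdep hsupp hosc hosca hlip hΛ hR)
    (su2_perturbedMassGapAt_quarter_dim4 hℓs hβ hWc hWdep hsupp hosc hosca hlip hlips hΛ hR hρ)

/-- ★ **`SU(2)`, EVERY `d ≥ 1`, QUARTER DOOR ⇒ THE OSTERWALDER–SEILER CLAUSE FOR EVERY DLR STATE OF THE MEMBER**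
(radius `2(d−1)|β_W|/4 ≤ 1`, row sum `(3/2)(d−1)|β_W| e^{a}(1 + 2√2 ℓ_s) + √2 Λ < 1`, ds-4's
`su2_perturbedMassGapAt_quarter`): one rate for all truncated correlations of bounded measurable local
observables, on `ℤ^d`. -/
theorem su2_massiveClause_quarter (hd : 1 ≤ d) {βW a ℓs Λ R : ℝ} (hℓs : 0 ≤ ℓs)
    (hrad : |βW / 4| * (2 * ((d : ℝ) - 1)) ≤ 1)
    {W : Potential (ZdEdge d) (Matrix.specialUnitaryGroup (Fin 2) ℂ)} (hWc : ∀ X, Continuous (W X))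
    (hWdep : ∀ X, DependsOn (W X) (↑X : Set (ZdEdge d)))
    {supp : Finset (ZdEdge d) → Finset (Finset (ZdEdge d))} (hsupp : W.IsSupportedBy supp)
    {osc : Finset (ZdEdge d) → ZdEdge d → ℝ} (hosc : ∀ X, Dobrushin.IsOscBound (W X) (osc X))
    (hosca : ∀ e, ∑ X ∈ (supp {e}).filter (fun X => e ∈ X), osc X e ≤ a)
    {lip : Finset (ZdEdge d) → ZdEdge d → ℝ} (hlip : ∀ X, IsLipBound suFrobDist (W X) (lip X))
    (hlips : ∀ e, ∑ X ∈ (supp {e}).filter (fun X => e ∈ X), lip X e ≤ ℓs)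
    (hΛ : ∀ e, ∑ y ∈ perturbedNbr supp e, ∑ X ∈ (supp {e}).filter (fun X => e ∈ X), lip X y ≤ Λ)
    (hR : ∀ e, ∀ X ∈ supp {e}, e ∈ X → ∀ y ∈ X, ‖e.1 - y.1‖ ≤ R)
    (hρ : 3 / 2 * ((d : ℝ) - 1) * |βW| * (Real.exp a * (1 + 2 * Real.sqrt 2 * ℓs)) + Real.sqrt 2 * Λ < 1) :
    ∀ μ ∈ perturbedGibbsMeasures (d := d) (fundamentalRep (Fin 2)) (((2 : ℕ) : ℝ) * (βW / 4)) W supp,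
      ∃ m : ℝ, ∀ F₁ F₂ : LGConfig d (Matrix.specialUnitaryGroup (Fin 2) ℂ) → ℝ,
        Literature.MathematicalPhysics.QuantumLattice.IsLocalObservable F₁ →
        Literature.MathematicalPhysics.QuantumLattice.IsLocalObservable F₂ →
        Measurable F₁ → Measurable F₂ → (∃ C, ∀ U, |F₁ U| ≤ C) → (∃ C, ∀ U, |F₂ U| ≤ C) →
          HasExponentialDecayRate
            (fun x : Site d => cov[F₁, fun U => F₂ (Literature.MathematicalPhysics.QuantumLattice.configShift x U); μ]) m :=
  massiveClause_of_perturbedMassGapAt hd (by norm_num) (memBallZd_of_loads hWc hWdep hsupp hosc hosca hlip hΛ hR)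
    (su2_perturbedMassGapAt_quarter hd hℓs hrad hWc hWdep hsupp hosc hosca hlip hlips hΛ hR hρ)

/-- **Wilson-coupling reading of the `d = 4` quarter row** (tree coupling `β_W/2`). -/
theorem su2_massive_quarter_dim4_wilson {βW a ℓs Λ R : ℝ} (hℓs : 0 ≤ ℓs) (hβ : |βW| ≤ 2 / 3)
    {W : Potential (ZdEdge 4) (Matrix.specialUnitaryGroup (Fin 2) ℂ)} (hWc : ∀ X, Continuous (W X))
    (hWdep : ∀ X, DependsOn (W X) (↑X : Set (ZdEdge 4)))
    {supp : Finset (ZdEdge 4) → Finset (Finset (ZdEdge 4))} (hsupp : W.IsSupportedBy supp)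
    {osc : Finset (ZdEdge 4) → ZdEdge 4 → ℝ} (hosc : ∀ X, Dobrushin.IsOscBound (W X) (osc X))
    (hosca : ∀ e, ∑ X ∈ (supp {e}).filter (fun X => e ∈ X), osc X e ≤ a)
    {lip : Finset (ZdEdge 4) → ZdEdge 4 → ℝ} (hlip : ∀ X, IsLipBound suFrobDist (W X) (lip X))
    (hlips : ∀ e, ∑ X ∈ (supp {e}).filter (fun X => e ∈ X), lip X e ≤ ℓs)
    (hΛ : ∀ e, ∑ y ∈ perturbedNbr supp e, ∑ X ∈ (supp {e}).filter (fun X => e ∈ X), lip X y ≤ Λ)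
    (hR : ∀ e, ∀ X ∈ supp {e}, e ∈ X → ∀ y ∈ X, ‖e.1 - y.1‖ ≤ R)
    (hρ : 9 / 2 * |βW| * (Real.exp a * (1 + 2 * Real.sqrt 2 * ℓs)) + Real.sqrt 2 * Λ < 1) :
    ∀ μ ∈ perturbedGibbsMeasures (d := 4) (fundamentalRep (Fin 2)) (βW / 2) W supp,
      IsMassiveState μ ∧ HasExponentialDecay (plaquetteCorrFn (fundamentalRep (Fin 2)) μ) := by
  have e : (((2 : ℕ) : ℝ) * (βW / 4)) = βW / 2 := by push_cast; ring
  rw [← e]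
  exact (su2_massive_quarter_dim4 hℓs hβ hWc hWdep hsupp hosc hosca hlip hlips hΛ hR hρ).2

end Summit.Ventures.YMGap.RobustBall

end
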